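import Mathlib

/-!
# `stub_lowCount` — binomial-tail arithmetic for short Majorana words

stub_lowCount of line Sketch of crux stmt-QuantumAdvantage-10730: the binomial-tail arithmetic
behind "short Majorana words are peak-free".

For every `γ < 1/2` there are `δ > 0` and `n₀` such that for all `n ≥ n₀` and all `L ≤ δ n`,
`4 · 2^{-n} · Σ_{k=1}^{L} C(4n,k) ≤ 2^{-2γn}`.

Proof.  Write `η := 1 - 2γ > 0`, `s := min (1/2) (η/20)`, `δ := s²`, `t := s²/4`.
* Generating-function tail bound (`sum_Icc_choose_mul_pow_le`): for `0 ≤ t ≤ 1` and `L ≤ N`,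
  `(Σ_{k=1}^{L} C(N,k)) · t^L ≤ Σ_k C(N,k) t^k = (1+t)^N`.
* `(1+t)^{4n} ≤ exp(4nt) = exp(s²n) ≤ exp(sn)` and `t^{-L} = (2/s)^{2L} ≤ exp(2L · 2/s) ≤ exp(4sn)`
  (both from `1 + x ≤ exp x` and `L ≤ s² n`), so `Σ_{k=1}^{L} C(4n,k) ≤ exp(5sn)`.
* Finally `4 · 2^{-n} · exp(5sn) ≤ exp(3 - n log 2 + 5sn) ≤ exp(-2γ n log 2) = 2^{-2γn}` as soon as
  `5s ≤ η/4`, `log 2 > 1/2` and `η n ≥ 12` (the choice `n₀ := ⌈12/η⌉₊`).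
-/

set_option linter.dupNamespace false -- D-0017: single-problem summit ⇒ `QuantumAdvantage.QuantumAdvantage` by design

noncomputable section

namespace Summit.QuantumAdvantage.QuantumAdvantage.Theorems.SymplecticPurity.CompositeFrameBound

/-- Generating-function bound on a binomial tail: for `0 ≤ t ≤ 1` and `L ≤ N`,
`(Σ_{k=1}^{L} C(N,k)) · t^L ≤ (t+1)^N` (each `C(N,k) t^L ≤ C(N,k) t^k`, then the binomial theorem). -/
theorem sum_Icc_choose_mul_pow_le (N L : ℕ) (hLN : L ≤ N) (t : ℝ) (ht0 : 0 ≤ t) (ht1 : t ≤ 1) :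
    (∑ k ∈ Finset.Icc 1 L, (N.choose k : ℝ)) * t ^ L ≤ (t + 1) ^ N := by
  rw [Finset.sum_mul]
  calc ∑ k ∈ Finset.Icc 1 L, (N.choose k : ℝ) * t ^ L
      ≤ ∑ k ∈ Finset.Icc 1 L, (N.choose k : ℝ) * t ^ k := by
        refine Finset.sum_le_sum fun k hk => ?_
        exact mul_le_mul_of_nonneg_left
          (pow_le_pow_of_le_one ht0 ht1 (Finset.mem_Icc.1 hk).2) (Nat.cast_nonneg _)
    _ ≤ ∑ k ∈ Finset.range (N + 1), (N.choose k : ℝ) * t ^ k := by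
        refine Finset.sum_le_sum_of_subset_of_nonneg (fun k hk => ?_) (fun k _ _ => by positivity)
        rw [Finset.mem_range]
        have := (Finset.mem_Icc.1 hk).2
        omega
    _ = (t + 1) ^ N := by
        rw [add_pow]
        exact Finset.sum_congr rfl fun k _ => by rw [one_pow, mul_one, mul_comm]

/-- **stub_lowCount** (line `Sketch` of crux stmt-QuantumAdvantage-10730).  For every `γ < 1/2`
there is `δ > 0` such that for all large `n` and every `L ≤ δ n`,
`4 · 2^{-n} · Σ_{k=1}^{L} C(2(n+n),k) ≤ 2^{-2γn}`: the count of Jordan–Wigner Majorana words of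
length `≤ δn` against the flatness `2^{1-n/2}` of the Clifford image of the cube state. -/
theorem stub_lowCount :
    ∀ γ : ℝ, γ < 1 / 2 → ∃ δ : ℝ, 0 < δ ∧ ∃ n₀ : ℕ, ∀ n ≥ n₀, ∀ L : ℕ, (L : ℝ) ≤ δ * n →
      4 * ((2 : ℝ) ^ n)⁻¹ * ∑ k ∈ Finset.Icc 1 L, ((2 * (n + n)).choose k : ℝ) ≤
        (2 : ℝ) ^ (-(2 * γ * (n : ℝ))) := by
  intro γ hγ
  have hη : 0 < 1 - 2 * γ := by linarith
  obtain ⟨s, hs⟩ : ∃ s : ℝ, s = min (1 / 2) ((1 - 2 * γ) / 20) := ⟨_, rfl⟩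
  have hs0 : 0 < s := hs ▸ lt_min (by norm_num) (by positivity)
  have hs1 : s ≤ 1 / 2 := hs ▸ min_le_left _ _
  have hsη : s ≤ (1 - 2 * γ) / 20 := hs ▸ min_le_right _ _
  clear hs
  refine ⟨s ^ 2, by positivity, ⌈12 / (1 - 2 * γ)⌉₊, fun n hn L hL => ?_⟩
  -- the threshold: `(1 - 2γ) n ≥ 12`
  have hn' : 12 ≤ (1 - 2 * γ) * n := by
    have h1 : 12 / (1 - 2 * γ) ≤ n := (Nat.le_ceil _).trans (by exact_mod_cast hn)
    rw [div_le_iff₀ hη] at h1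
    linarith
  -- `L ≤ n ≤ 4n`
  have hs21 : s ^ 2 ≤ 1 := by nlinarith
  have hLN : L ≤ 2 * (n + n) := by
    have h1 : (L : ℝ) ≤ n := hL.trans (mul_le_of_le_one_left (Nat.cast_nonneg n) hs21)
    have h2 : L ≤ n := by exact_mod_cast h1
    omega
  -- generating-function tail bound with `t = s² / 4`
  set S := ∑ k ∈ Finset.Icc 1 L, ((2 * (n + n)).choose k : ℝ)
  have hA : S * (s ^ 2 / 4) ^ L ≤ (s ^ 2 / 4 + 1) ^ (2 * (n + n)) :=
    sum_Icc_choose_mul_pow_le _ _ hLN _ (by positivity) (by nlinarith)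
  -- `(1 + t)^{4n} ≤ exp (4 n t) = exp (s² n) ≤ exp (s n)`
  have hB : (s ^ 2 / 4 + 1) ^ (2 * (n + n)) ≤ Real.exp (s * n) := by
    calc (s ^ 2 / 4 + 1) ^ (2 * (n + n)) ≤ Real.exp (s ^ 2 / 4) ^ (2 * (n + n)) :=
          pow_le_pow_left₀ (by positivity) (Real.add_one_le_exp _) _
      _ = Real.exp ((2 * (n + n) : ℕ) * (s ^ 2 / 4)) := (Real.exp_nat_mul _ _).symm
      _ ≤ Real.exp (s * n) := by
          rw [Real.exp_le_exp]
          push_cast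
          have hss : s ^ 2 ≤ s := by nlinarith
          have := mul_le_mul_of_nonneg_left hss (Nat.cast_nonneg (α := ℝ) n)
          nlinarith [this]
  -- `(2/s)^{2L} ≤ exp (2L · 2/s) ≤ exp (4 s n)`
  have hC : (2 / s) ^ (2 * L) ≤ Real.exp (4 * s * n) := by
    have hu : 0 ≤ 2 / s := by positivity
    calc (2 / s) ^ (2 * L) ≤ Real.exp (2 / s) ^ (2 * L) :=
          pow_le_pow_left₀ hu (by linarith [Real.add_one_le_exp (2 / s)]) _
      _ = Real.exp ((2 * L : ℕ) * (2 / s)) := (Real.exp_nat_mul _ _).symm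
      _ ≤ Real.exp (4 * s * n) := by
          rw [Real.exp_le_exp]
          have h1 : (L : ℝ) / s ≤ s * n := by
            rw [div_le_iff₀ hs0]
            calc (L : ℝ) ≤ s ^ 2 * n := hL
              _ = s * n * s := by ring
          push_cast
          calc (2 * (L : ℝ)) * (2 / s) = 4 * ((L : ℝ) / s) := by ring
            _ ≤ 4 * (s * n) := by linarith
            _ = 4 * s * n := by ring
  -- `t^L · (2/s)^{2L} = 1`
  have hD : (s ^ 2 / 4) ^ L * (2 / s) ^ (2 * L) = 1 := by
    rw [pow_mul, ← mul_pow]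
    have hsne : s ≠ 0 := hs0.ne'
    have : s ^ 2 / 4 * (2 / s) ^ 2 = 1 := by
      field_simp
      ring
    rw [this, one_pow]
  have hS : S ≤ Real.exp (5 * s * n) := by
    calc S = S * ((s ^ 2 / 4) ^ L * (2 / s) ^ (2 * L)) := by rw [hD, mul_one]
      _ = S * (s ^ 2 / 4) ^ L * (2 / s) ^ (2 * L) := by ring
      _ ≤ (s ^ 2 / 4 + 1) ^ (2 * (n + n)) * (2 / s) ^ (2 * L) :=
          mul_le_mul_of_nonneg_right hA (by positivity)
      _ ≤ Real.exp (s * n) * Real.exp (4 * s * n) :=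
          mul_le_mul hB hC (by positivity) (by positivity)
      _ = Real.exp (5 * s * n) := by rw [← Real.exp_add]; ring_nf
  -- assemble: everything as `exp`, then compare exponents
  have h2n : ((2 : ℝ) ^ n)⁻¹ = Real.exp (-(Real.log 2 * n)) := by
    rw [Real.exp_neg, ← Real.rpow_natCast, Real.rpow_def_of_pos two_pos]
  have hlog2 : (1 : ℝ) / 2 < Real.log 2 := by linarith [Real.log_two_gt_d9]
  have p1 : 0 ≤ ((1 - 2 * γ) / 4 - 5 * s) * n := mul_nonneg (by linarith) (Nat.cast_nonneg n)
  have p2 : 0 ≤ (Real.log 2 - 1 / 2) * ((1 - 2 * γ) * n) :=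
    mul_nonneg (by linarith) (mul_nonneg hη.le (Nat.cast_nonneg n))
  calc 4 * ((2 : ℝ) ^ n)⁻¹ * S ≤ 4 * ((2 : ℝ) ^ n)⁻¹ * Real.exp (5 * s * n) :=
        mul_le_mul_of_nonneg_left hS (by positivity)
    _ ≤ Real.exp 3 * Real.exp (-(Real.log 2 * n)) * Real.exp (5 * s * n) := by
        rw [h2n]
        gcongr
        linarith [Real.add_one_le_exp (3 : ℝ)]
    _ = Real.exp (3 - Real.log 2 * n + 5 * s * n) := by
        rw [← Real.exp_add, ← Real.exp_add]
        ring_nf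
    _ ≤ Real.exp (Real.log 2 * (-(2 * γ * (n : ℝ)))) := by
        rw [Real.exp_le_exp]
        linarith
    _ = (2 : ℝ) ^ (-(2 * γ * (n : ℝ))) := (Real.rpow_def_of_pos two_pos _).symm

end Summit.QuantumAdvantage.QuantumAdvantage.Theorems.SymplecticPurity.CompositeFrameBound
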